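import Mathlib
import HarnessLib
import Summits.NavierStokesRegularity.NavierStokesRegularity.Theses.PoloidalWindowDoor
import Summits.NavierStokesRegularity.NavierStokesRegularity.Theorems.PoloidalWindowDoorPoloidalWindowRigiditySharper
import Summits.NavierStokesRegularity.NavierStokesRegularity.Theorems.PoloidalWindowDoorPoloidalWindowRigidityTimeShearClosed
import Summits.NavierStokesRegularity.NavierStokesRegularity.Theorems.PoloidalWindowDoorPoloidalWindowRigidityLrcSpatialOfJets

/-!
# Route `PoloidalWindowDoor`, item `LrcModEntire` (stmt-NavierStokesRegularity-20428, the promoted stub of crux K2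
# `PoloidalWindowRigidity` = stmt-NavierStokesRegularity-19708): THE ITEM AND THE CRUX FROM POINTWISE ALL-ORDERS
# KILLING JETS AT PINNED POINTS (class form)

Cell ns-regularity-ideate, seat nsreg-p7 gen 9 (structural worker of record on `LrcModEntire`, DIRECTOR-NS g8 #31).
ns-poloidal-K2-p3 g4's `…LrcSpatialOfJets.lrcSpatial_of_pointwise_killing_jets` (p526243) removed all topology from
v2's registered stub: it suffices to know, at every point `(s, y₀)` of the backward slab which is non-degenerate
(`ω ≠ 0`, `∇_h v₂ ≠ 0`, `∂₂v_h ≠ 0`) and pinned (`D_y(∂₂v_b/∂_b v₂)(s,·)(y₀) ≠ 0` for some `b ∈ {0,1}` with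
`∂_b v₂(s,y₀) ≠ 0`), that for every order `N` some nonzero `p ∈ ℝ³` kills the `N`-jet at `y₀` of
`p₀ Dω[e₀] + p₁ Dω[e₁] + p₂ (Dω[J·] − Jω)` (`ω = curl v(s)`).  This file records the two consequences the new
item's lead and the certificate lane (ns-poloidal-K2-cert-1) need, quantified over the class:

* `lrcModEntire_of_pointwise_killing_jets` — **(class + poloidal ⇒ pointwise all-orders Killing jets at every
  pinned point) ⇒ the statement of `LrcModEntire`** (verbatim; the route declaration unfolds to it by `rfl` — it is
  spelled out only because the farm snapshot of the route file predates the item);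
* `poloidalWindowRigidity_of_pointwise_killing_jets` — **the same hypothesis ⇒ the crux `PoloidalWindowRigidity`**
  (by name), through K2-p3's `nonflatLiouville_of_pointwise_killing_jets`, ns-poloidal-K2-p2 g3's `tv_holds`
  ((TV) is a tree theorem) and the K2 lead's `…Sharper.poloidalWindowRigidity_of_sliceSharpNonflatLiouville`.

WHAT THIS IS NOT: not a claim about Navier–Stokes regularity, not a proof of `LrcModEntire` — a reduction of the
promoted item to the pointwise statement the structural / certificate lanes attack (bears_on LADDER-NS N0, rung
N0-LocalTubeDoorPoloidal; `--supports` the item).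
-/

noncomputable section

-- the summit and its single sub-problem share the name (CONVENTIONS §1), as in every Theorems file
set_option linter.dupNamespace false

namespace Summit.NavierStokesRegularity.NavierStokesRegularity.Theorems.PoloidalWindowDoorLrcModEntireOfJets

open Set Function
open scoped RealInnerProductSpace InnerProductSpace
open Literature.Analysis Literature.Analysis.FluidPDE
open Summit.NavierStokesRegularity.NavierStokesRegularity.Theses.PoloidalWindowDoor (PoloidalWindowRigidity)
open Summit.NavierStokesRegularity.NavierStokesRegularity.Theorems.PoloidalWindowDoorPoloidalWindowRigiditySharper
open Summit.NavierStokesRegularity.NavierStokesRegularity.Theorems.PoloidalWindowDoorPoloidalWindowRigidityTimeShearClosed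
open Summit.NavierStokesRegularity.NavierStokesRegularity.Theorems.PoloidalWindowDoorPoloidalWindowRigidityLrcSpatialOfJets

/-- **`LrcModEntire` ⇐ POINTWISE ALL-ORDERS KILLING JETS AT PINNED POINTS (class form).**  If for every profile of
the route's Type-I class, poloidal along `e₃`, every non-degenerate pinned point of the slab carries Killing jets of
all orders (the hypothesis `hP` of ns-poloidal-K2-p3 g4's `lrcSpatial_of_pointwise_killing_jets`, quantified over
the class), then the statement of the item `LrcModEntire` (stmt-NavierStokesRegularity-20428) holds — with its first
two alternatives only. -/
theorem lrcModEntire_of_pointwise_killing_jets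
    (hP : ∀ (C : ℝ) (v : ℝ → EuclideanSpace ℝ (Fin 3) → EuclideanSpace ℝ (Fin 3)),
      HasTypeITimeDecay C v →
      ContinuousOn (Function.uncurry v) (Set.Iio (0 : ℝ) ×ˢ Set.univ) →
      (∀ s t : ℝ, s < t → t < 0 → ∀ x, v t x =
        UnboundedOperators.heatExtension (v s) (t - s) x - oseenDuhamel 1 s v v t x) →
      (∀ t < 0, VectorCalculus.IsDivFree (v t)) →
      (∀ s < 0, ∀ y, ⟪curl (v s) y, EuclideanSpace.single 2 1⟫_ℝ = 0) →
      ∀ s < 0, ∀ y₀ : EuclideanSpace ℝ (Fin 3), curl (v s) y₀ ≠ 0 →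
        (fderiv ℝ (v s) y₀ (EuclideanSpace.single 0 1) 2 ≠ 0 ∨ fderiv ℝ (v s) y₀ (EuclideanSpace.single 1 1) 2 ≠ 0) →
        (fderiv ℝ (v s) y₀ (EuclideanSpace.single 2 1) 0 ≠ 0 ∨ fderiv ℝ (v s) y₀ (EuclideanSpace.single 2 1) 1 ≠ 0) →
        (∃ b : Fin 3, b ≠ 2 ∧ fderiv ℝ (v s) y₀ (EuclideanSpace.single b 1) 2 ≠ 0 ∧
          fderiv ℝ (fun y => fderiv ℝ (v s) y (EuclideanSpace.single 2 1) b / fderiv ℝ (v s) y (EuclideanSpace.single b 1) 2)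
            y₀ ≠ 0) →
        ∀ N : ℕ, ∃ p : Fin 3 → ℝ, p ≠ 0 ∧ ∀ n ≤ N,
          p 0 • iteratedFDeriv ℝ n (fun y => fderiv ℝ (curl (v s)) y (EuclideanSpace.single 0 1)) y₀ +
          p 1 • iteratedFDeriv ℝ n (fun y => fderiv ℝ (curl (v s)) y (EuclideanSpace.single 1 1)) y₀ +
          p 2 • iteratedFDeriv ℝ n (fun y => fderiv ℝ (curl (v s)) y (rotGen y) - rotGen (curl (v s) y)) y₀ = 0) :
    (∀ (C : ℝ) (v : ℝ → EuclideanSpace ℝ (Fin 3) → EuclideanSpace ℝ (Fin 3)),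
      HasTypeITimeDecay C v →
      ContinuousOn (Function.uncurry v) (Set.Iio (0 : ℝ) ×ˢ Set.univ) →
      (∀ s t : ℝ, s < t → t < 0 → ∀ x, v t x =
        UnboundedOperators.heatExtension (v s) (t - s) x - oseenDuhamel 1 s v v t x) →
      (∀ t < 0, VectorCalculus.IsDivFree (v t)) →
      (∀ s < 0, ∀ y, ⟪curl (v s) y, EuclideanSpace.single 2 1⟫_ℝ = 0) →
      ∀ W : Set (ℝ × EuclideanSpace ℝ (Fin 3)), IsOpen W → W.Nonempty → W ⊆ Set.Iio (0 : ℝ) ×ˢ Set.univ →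
        (∀ z ∈ W, curl (v z.1) z.2 ≠ 0 ∧
          (fderiv ℝ (v z.1) z.2 (EuclideanSpace.single 0 1) 2 ≠ 0 ∨ fderiv ℝ (v z.1) z.2 (EuclideanSpace.single 1 1) 2 ≠ 0) ∧
          (fderiv ℝ (v z.1) z.2 (EuclideanSpace.single 2 1) 0 ≠ 0 ∨ fderiv ℝ (v z.1) z.2 (EuclideanSpace.single 2 1) 1 ≠ 0)) →
        (∀ m : ℝ → ℝ, ∀ W₁ : Set (ℝ × EuclideanSpace ℝ (Fin 3)), W₁ ⊆ W → IsOpen W₁ → W₁.Nonempty →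
          ∃ z ∈ W₁, ∃ b : Fin 3, b ≠ 2 ∧
            fderiv ℝ (v z.1) z.2 (EuclideanSpace.single 2 1) b ≠ m z.1 * fderiv ℝ (v z.1) z.2 (EuclideanSpace.single b 1) 2) →
        ∃ s : ℝ, s < 0 ∧ ∃ U : Set (EuclideanSpace ℝ (Fin 3)), IsOpen U ∧ U.Nonempty ∧
          ((∃ e : EuclideanSpace ℝ (Fin 3), e ≠ 0 ∧ ∀ y ∈ U, fderiv ℝ (curl (v s)) y e = 0) ∨
           (∃ c : EuclideanSpace ℝ (Fin 3), ∀ y ∈ U,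
              rotGen (curl (v s) y) = fderiv ℝ (curl (v s)) y (rotGen (y - c))) ∨
           (∃ w : EuclideanSpace ℝ (Fin 3) → EuclideanSpace ℝ (Fin 3), AnalyticOnNhd ℝ w Set.univ ∧
              ¬ BddAbove (Set.range fun y => ‖w y‖) ∧ ∀ y ∈ U, v s y = w y))) := by
  intro C v hrate hcont hmild hdiv hpol W hW hWne hWs hnd hpin
  obtain ⟨s, hs, U, hU, hUne, halt⟩ := lrcSpatial_of_pointwise_killing_jets hrate hcont hmild hdiv hpol
    (hP C v hrate hcont hmild hdiv hpol) W hW hWne hWs hnd hpin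
  rcases halt with htr | hrot
  · exact ⟨s, hs, U, hU, hUne, Or.inl htr⟩
  · exact ⟨s, hs, U, hU, hUne, Or.inr (Or.inl hrot)⟩

/-- **The crux K2 `PoloidalWindowRigidity` ⇐ POINTWISE ALL-ORDERS KILLING JETS AT PINNED POINTS (class form)** —
the conclusion is the route declaration by name; proof: K2-p3 g4's `nonflatLiouville_of_pointwise_killing_jets` with
the (TV) half supplied by K2-p2 g3's tree theorem `tv_holds`, inside the K2 lead's slice-sharp reduction. -/
theorem poloidalWindowRigidity_of_pointwise_killing_jets
    (hP : ∀ (C : ℝ) (v : ℝ → EuclideanSpace ℝ (Fin 3) → EuclideanSpace ℝ (Fin 3)),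
      HasTypeITimeDecay C v →
      ContinuousOn (Function.uncurry v) (Set.Iio (0 : ℝ) ×ˢ Set.univ) →
      (∀ s t : ℝ, s < t → t < 0 → ∀ x, v t x =
        UnboundedOperators.heatExtension (v s) (t - s) x - oseenDuhamel 1 s v v t x) →
      (∀ t < 0, VectorCalculus.IsDivFree (v t)) →
      (∀ s < 0, ∀ y, ⟪curl (v s) y, EuclideanSpace.single 2 1⟫_ℝ = 0) →
      ∀ s < 0, ∀ y₀ : EuclideanSpace ℝ (Fin 3), curl (v s) y₀ ≠ 0 →
        (fderiv ℝ (v s) y₀ (EuclideanSpace.single 0 1) 2 ≠ 0 ∨ fderiv ℝ (v s) y₀ (EuclideanSpace.single 1 1) 2 ≠ 0) →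
        (fderiv ℝ (v s) y₀ (EuclideanSpace.single 2 1) 0 ≠ 0 ∨ fderiv ℝ (v s) y₀ (EuclideanSpace.single 2 1) 1 ≠ 0) →
        (∃ b : Fin 3, b ≠ 2 ∧ fderiv ℝ (v s) y₀ (EuclideanSpace.single b 1) 2 ≠ 0 ∧
          fderiv ℝ (fun y => fderiv ℝ (v s) y (EuclideanSpace.single 2 1) b / fderiv ℝ (v s) y (EuclideanSpace.single b 1) 2)
            y₀ ≠ 0) →
        ∀ N : ℕ, ∃ p : Fin 3 → ℝ, p ≠ 0 ∧ ∀ n ≤ N,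
          p 0 • iteratedFDeriv ℝ n (fun y => fderiv ℝ (curl (v s)) y (EuclideanSpace.single 0 1)) y₀ +
          p 1 • iteratedFDeriv ℝ n (fun y => fderiv ℝ (curl (v s)) y (EuclideanSpace.single 1 1)) y₀ +
          p 2 • iteratedFDeriv ℝ n (fun y => fderiv ℝ (curl (v s)) y (rotGen y) - rotGen (curl (v s) y)) y₀ = 0) :
    PoloidalWindowRigidity :=
  poloidalWindowRigidity_of_sliceSharpNonflatLiouville fun C v hrate hcont hmild hdiv hpol _ _ _ _ _ _ _ =>
    nonflatLiouville_of_pointwise_killing_jets hrate hcont hmild hdiv hpol (hP C v hrate hcont hmild hdiv hpol)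
      (tv_holds hrate hcont hmild hdiv hpol)

end Summit.NavierStokesRegularity.NavierStokesRegularity.Theorems.PoloidalWindowDoorLrcModEntireOfJets

end
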